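import Mathlib
import Literature.MathematicalPhysics.QuantumFieldTheory.Balaban1983to89.B1Eq324BenfattoClassDecoupling
import Literature.Analysis.Matrix.LogDetTraceBounds
import HarnessLib

/-!
# `Balaban1983to89.B1Eq324BenfattoClassDecouplingExtensive` — the substitute for [BenfattoEtAl1978] (5.13) p. 155 at an exponentially decaying
# precision, |I|-EXTENSIVE form: two-sided Gaussian domination by the BLOCK-DIAGONAL precision shifted by the DIAGONAL of the cross row sums,
# `B_bd ∓ diag(r)`, with prefactor `exp(±Σ_y r_y/(γ − r_max))` — PROVED (kernel-generic; sequel of `B1Eq324BenfattoClassDecoupling`)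

statement-level skeleton of published theorems with citation tags; proofs where landed; nothing here is a claim about the
Yang–Mills mass gap

WHY THIS MODULE (cell `pub-ymgap`, seat `dag-n08-b` gen 7).  `B1Eq324BenfattoClassDecoupling.decoupling` replaces the Markov factorisation (5.13)
of [BenfattoEtAl1978] §5 at a precision with exponentially decaying (non finite-range) entries — the situation of [Balaban1985UV3] (58) by
[Balaban1985BackgroundPropagators] Sect. E p. 428 — by a SCALAR two-sided comparison `(1−δ)B_bd ≤ B ≤ (1+δ)B_bd`, whose price is a prefactor
`((1+δ)/(1−δ))^{±|m|/2}` extensive in the WHOLE index set `m = Γᶜ` (its header's «VOLUME FACTOR» caveat: adequate for (58), whose error is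
`|T₁^{(k)}|`-extensive, not faithful to [BenfattoEtAl1978]'s infinite lattice where only the boxes near `I` carry a Hamiltonian).  This file removes
the caveat: the cross part of `B` is dominated by the DIAGONAL form of its row sums `r_y` (position-dependent Schur test), so
`B_bd − diag(r) ≤ B ≤ B_bd + diag(r)`; the comparison precisions are still block-diagonal (independent boxes) and the ratio of the two
normalisations is a determinant ratio `√(det(B_bd + R)/det(B_bd − R))` bounded through the Weinstein–Aronszajn identity and `ln det N ≤ tr N − n` by
`exp(Σ_y r_y/(γ − r_max))` — extensive in the CROSS MASS `Σ_y r_y`, which for a `w`-separated partition is carried by the corridor-adjacent sites and is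
exponentially small in `w`.  Each comparison box precision `B|_p ∓ R|_p` is coercive with `γ − r_max` and has the SAME Combes–Thomas defect rows as `B`
(a diagonal shift has weight zero), i.e. stays in the class of `B1Eq324BenfattoClassAppendixC` with unchanged `J`.

THE PRINTED TEXT being replaced (p. 155, (5.13)): after conditioning on the corridor variables «the integral factorizes» over the boxes.

DICTIONARY.  As in `B1Eq324BenfattoClassDecoupling`: finite index set `m` (= `Γᶜ`), symmetric `γ`-coercive precision `B` (= `A|_{Γᶜ}`, inverse = `C^Γ`), a part
map `π : m → σ`, the block-diagonal part `B_bd` (inlined `Matrix.of …`), cross-row-sum bounds `r : m → ℝ` (`Σ_{π y′ ≠ π y}|B y y′| ≤ r_y ≤ r_max < γ`),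
`R = Matrix.diagonal r`; Gaussian vectors in precision form `multivariateGaussian 0 P⁻¹` with `GaussianToolkit.gaussWeight` / `gaussZ`.

WHAT IS PROVED (no definition, no named fact, no `sorry`; axioms standard).
* §1 `det_toEuclideanCLM` (`LinearMap.det` of the Euclidean operator = `Matrix.det`; Mathlib `toEuclideanLin_eq_toLin_orthonormal` + `LinearMap.det_toLin`),
  `det_sqrt_pos_and_sq`, ★ `gaussZ_eq_det` (`Z_P = (√(2π))^{|ι|}/√(det P)` — the exact Gaussian integral of a positive definite form, by the change of
  variables `GaussianToolkit.sqrtCLE` + `Measure.map_linearMap_addHaar_eq_smul_addHaar` + `GaussianToolkit.lintegral_exp_neg_norm_sq_div_two`),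
  `gaussZ_mul_sqrt_det_eq`.
* §2 `gaussZ_inv_mul_gaussZ_eq` (`Z_{P₊}⁻¹Z_{P₋} = √(det P₊/det P₋)`), ★★ `lintegral_multivariateGaussian_le_of_sandwich` / `_ge_of_sandwich`: for positive
  definite `P₋ ≤ P₁ ≤ P₊` (as forms) and measurable `F ≥ 0`,
  `√(det P₋/det P₊)∫F dN(0,P₊⁻¹) ≤ ∫F dN(0,P₁⁻¹) ≤ √(det P₊/det P₋)∫F dN(0,P₋⁻¹)`.
* §3 `abs_form_cross_le_diag` (position-dependent Schur: `|⟨x,Ex⟩| ≤ Σ_y r_y x_y²`), `dot_blockDiag_add_diagonal`, ★ `form_sandwich_blockDiag_diag`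
  (`B_bd − R ≤ B ≤ B_bd + R`), `coercive_blockDiag_sub_diag` (`B_bd − R` is `(γ − r_max)`-coercive), ★★ `det_add_diag_le_det_mul_exp`
  (`det(M + diag(2r)) ≤ det M · exp(2Σ_y r_y/γ′)` for symmetric `γ′`-coercive `M`, `r ≥ 0`: Weinstein–Aronszajn `Matrix.det_one_add_mul_comm` +
  the tree's `Literature.Analysis.Matrix.LogDet.log_det_le_gauss_node` at `t = 1` + `(M⁻¹)_{yy} ≤ 1/γ′`).
* §4 ★★★ `decoupling_extensive` (the five conclusions: `B_bd ∓ R` positive definite, the sandwich, and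
  `e^{−ρ}∫F dN(0,(B_bd+R)⁻¹) ≤ ∫F dN(0,B⁻¹) ≤ e^{ρ}∫F dN(0,(B_bd−R)⁻¹)`, `ρ = Σ_y r_y/(γ − r_max)`), `inv_blockDiag_add_smul_diagonal_apply_eq_zero`
  (the comparison covariances have no entries across the partition), `rowDefect_blockDiag_add_smul_diagonal_le` (defect rows of `B_bd + cR` ≤ those of
  `B`), ★★ `decoupling_extensive_conditional` (at `B = A|_{Γᶜ}` for `A` in the class — uniform in `Γ`).
* §5 (v1.1, APPEND-ONLY) common-mean editions: `lintegral_multivariateGaussian_mean_le_of_sandwich` / `_mean_ge_of_sandwich`,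
  ★ `decoupling_extensive_mean`, `decoupling_extensive_conditional_mean` (the two integral conclusions for `N(u,·)` with a COMMON centre `u` —
  the form meeting the conditional law `N(u_Γ(ξ), C^Γ)`; the prefactor is extensive in the CROSS MASS `Σ_y r_y`, not in `|I|`),
  `sqrt_det_comparison_ratio_le_exp` (the determinant ratio of the two comparison precisions vs `e^{±ρ}`, exported for field-level transfers).

HONEST SCOPE.  Kernel-generic matrix analysis and Gaussian measure comparison; OUR reading of how §5 survives at [Balaban1985UV3]'s data, not print;
the common-mean versions follow as in `B1Eq324BenfattoClassDecoupling.lintegral_multivariateGaussian_mean_le_of_form_le` (translate `F`) and are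
stated in §5 (v1.1); block-diagonal precision ⇒ independent blocks (measure level) is the generic Gaussian layer of seat dag-n08-d's `…Kernel*` editions; the class
edition of §5 itself is NOT typed (plan g81, 2026-08-28: port not commissioned beyond definition-free pieces); nothing of [B10]/[B9] asserted; N08 NOT
discharged; count-neutral; nothing continuum / OS / mass-gap / Clay.
-/

noncomputable section

open Finset Matrix MeasureTheory ProbabilityTheory WithLp
open scoped BigOperators ENNReal MatrixOrder

namespace Literature.MathematicalPhysics.QuantumFieldTheory.Balaban1983to89.B1Eq324BenfattoClassDecouplingExtensive

open Literature.MathematicalPhysics.QuantumFieldTheory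
open Literature.MathematicalPhysics.QuantumFieldTheory.GaussianToolkit
open Literature.MathematicalPhysics.QuantumFieldTheory.Balaban1983to89.B1Eq324BenfattoClassAppendixC
open Literature.MathematicalPhysics.QuantumFieldTheory.Balaban1983to89.B1Eq324BenfattoClassDecoupling

/-! ## §1  The Gaussian integral as a determinant: `Z_P = (√(2π))^{|ι|}/√(det P)` -/

section GaussDet

variable {ι : Type*} [Fintype ι] [DecidableEq ι]

/-- The determinant of the Euclidean operator of a matrix is the determinant of the matrix (Mathlib: `toEuclideanLin` is `toLin` in
the standard orthonormal basis). [cite: HornJohnson2013, §0.3 (determinants; basis independence)] -/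
theorem det_toEuclideanCLM (A : Matrix ι ι ℝ) :
    LinearMap.det ((Matrix.toEuclideanCLM (n := ι) (𝕜 := ℝ) A : EuclideanSpace ℝ ι →L[ℝ] EuclideanSpace ℝ ι) :
      EuclideanSpace ℝ ι →ₗ[ℝ] EuclideanSpace ℝ ι) = A.det := by
  rw [Matrix.coe_toEuclideanCLM_eq_toEuclideanLin, Matrix.toEuclideanLin_eq_toLin_orthonormal, LinearMap.det_toLin]

/-- The square root of a positive definite real matrix has positive determinant, and its square is the determinant.
[cite: HornJohnson2013, Thm 7.2.6 (the positive definite square root)] -/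
theorem det_sqrt_pos_and_sq {S : Matrix ι ι ℝ} (hS : S.PosDef) :
    0 < (CFC.sqrt S).det ∧ (CFC.sqrt S).det ^ 2 = S.det := by
  have hsq : (CFC.sqrt S).det ^ 2 = S.det := by
    rw [sq, ← Matrix.det_mul, sqrt_mul_sqrt hS]
  have hne : (CFC.sqrt S).det ≠ 0 := by
    intro h
    have := hS.det_pos
    rw [← hsq, h] at this
    simp at this
  have hpsd : (CFC.sqrt S).PosSemidef := Matrix.nonneg_iff_posSemidef.mp (CFC.sqrt_nonneg S)
  exact ⟨lt_of_le_of_ne hpsd.det_nonneg (Ne.symm hne), hsq⟩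

/-- **The Gaussian integral as a determinant**: for a positive definite precision `P` on `ℝ^ι`,
`Z_P = ∫ e^{−½yᵀPy}dy = (√(2π))^{|ι|}/√(det P)` (change of variables `u = (√(P⁻¹))⁻¹y` through `GaussianToolkit.sqrtCLE`).
[cite: HornJohnson2013, §7.1 with Thm 7.2.6 (the Gaussian integral of a positive definite form)] -/
theorem gaussZ_eq_det {P : Matrix ι ι ℝ} (hP : P.PosDef) :
    gaussZ P = ENNReal.ofReal (Real.sqrt (2 * Real.pi) ^ Fintype.card ι / Real.sqrt P.det) := by
  have hPu : IsUnit P.det := (Matrix.isUnit_iff_isUnit_det _).1 hP.isUnit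
  have hS : P⁻¹.PosDef := hP.inv
  set T := sqrtCLE hS with hT
  -- the weight through `T.symm`
  have hw : ∀ y : EuclideanSpace ℝ ι, gaussWeight P y = ENNReal.ofReal (Real.exp (-‖T.symm y‖ ^ 2 / 2)) := by
    intro y
    simp only [gaussWeight]
    rw [norm_sqrtCLE_symm_sq hS y, Matrix.nonsing_inv_nonsing_inv P hPu, neg_div]
  -- change of variables under the linear automorphism `T.symm`
  have hdet_ne : LinearMap.det (T.symm.toLinearEquiv : EuclideanSpace ℝ ι →ₗ[ℝ] EuclideanSpace ℝ ι) ≠ 0 :=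
    (LinearEquiv.isUnit_det' T.symm.toLinearEquiv).ne_zero
  have hmap : (volume : Measure (EuclideanSpace ℝ ι)).map T.symm =
      ENNReal.ofReal |(LinearMap.det (T.symm.toLinearEquiv : EuclideanSpace ℝ ι →ₗ[ℝ] EuclideanSpace ℝ ι))⁻¹| •
        volume :=
    Measure.map_linearMap_addHaar_eq_smul_addHaar volume hdet_ne
  have hstep : gaussZ P = ∫⁻ u, ENNReal.ofReal (Real.exp (-‖u‖ ^ 2 / 2)) ∂((volume : Measure (EuclideanSpace ℝ ι)).map T.symm) := by
    rw [lintegral_map (by fun_prop) T.symm.continuous.measurable]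
    simp only [gaussZ]
    exact lintegral_congr hw
  rw [hstep, hmap, lintegral_smul_measure, lintegral_exp_neg_norm_sq_div_two, smul_eq_mul,
    ← ENNReal.ofReal_mul (abs_nonneg _)]
  congr 1
  -- the determinant of `T.symm` is `(det √(P⁻¹))⁻¹ = √(det P)`
  have hTdet : LinearMap.det (T.toLinearEquiv : EuclideanSpace ℝ ι →ₗ[ℝ] EuclideanSpace ℝ ι) = (CFC.sqrt P⁻¹).det := by
    have hcoe : (T.toLinearEquiv : EuclideanSpace ℝ ι →ₗ[ℝ] EuclideanSpace ℝ ι) =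
        ((Matrix.toEuclideanCLM (n := ι) (𝕜 := ℝ) (CFC.sqrt P⁻¹) : EuclideanSpace ℝ ι →L[ℝ] EuclideanSpace ℝ ι) :
          EuclideanSpace ℝ ι →ₗ[ℝ] EuclideanSpace ℝ ι) := by
      ext y : 1
      exact sqrtCLE_apply hS y
    rw [hcoe, det_toEuclideanCLM]
  have hsymmdet : LinearMap.det (T.symm.toLinearEquiv : EuclideanSpace ℝ ι →ₗ[ℝ] EuclideanSpace ℝ ι) =
      ((CFC.sqrt P⁻¹).det)⁻¹ := by
    rw [← hTdet]
    exact LinearEquiv.det_coe_symm T.toLinearEquiv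
  obtain ⟨hspos, hssq⟩ := det_sqrt_pos_and_sq hS
  rw [hsymmdet, inv_inv, abs_of_pos hspos]
  -- `det √(P⁻¹) = 1/√(det P)`
  have hdetinv : (P⁻¹).det = (P.det)⁻¹ := by
    rw [Matrix.det_nonsing_inv, Ring.inverse_eq_inv']
  have hs : (CFC.sqrt P⁻¹).det = (Real.sqrt P.det)⁻¹ := by
    have h1 : (CFC.sqrt P⁻¹).det = Real.sqrt ((CFC.sqrt P⁻¹).det ^ 2) := (Real.sqrt_sq hspos.le).symm
    rw [h1, hssq, hdetinv, Real.sqrt_inv]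
  rw [hs, div_eq_mul_inv, mul_comm]

/-- **Ratio of Gaussian integrals**: `Z_{P₁}/Z_{P₂} = √(det P₂/det P₁)`, in the product form `Z_{P₁}·√(det P₁) = Z_{P₂}·√(det P₂)`.
[cite: HornJohnson2013, §7.1 (the Gaussian integral of a positive definite form)] -/
theorem gaussZ_mul_sqrt_det_eq {P₁ P₂ : Matrix ι ι ℝ} (hP₁ : P₁.PosDef) (hP₂ : P₂.PosDef) :
    gaussZ P₁ * ENNReal.ofReal (Real.sqrt P₁.det) = gaussZ P₂ * ENNReal.ofReal (Real.sqrt P₂.det) := by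
  have h : ∀ {P : Matrix ι ι ℝ}, P.PosDef → gaussZ P * ENNReal.ofReal (Real.sqrt P.det) =
      ENNReal.ofReal (Real.sqrt (2 * Real.pi) ^ Fintype.card ι) := by
    intro P hP
    have hd : 0 < Real.sqrt P.det := Real.sqrt_pos.2 hP.det_pos
    rw [gaussZ_eq_det hP, ← ENNReal.ofReal_mul (by positivity), div_mul_cancel₀ _ hd.ne']
  rw [h hP₁, h hP₂]

end GaussDet

/-! ## §2  Gaussian domination between two precisions that SANDWICH the given one (additive comparison) -/

section Sandwich

variable {ι : Type*} [Fintype ι] [DecidableEq ι]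

/-- The ratio of normalisations as a determinant ratio: `Z_{P₊}⁻¹·Z_{P₋} = √(det P₊/det P₋)`.
[cite: HornJohnson2013, §7.1 (the Gaussian integral of a positive definite form)] -/
theorem gaussZ_inv_mul_gaussZ_eq {Pm Pp : Matrix ι ι ℝ} (hPm : Pm.PosDef) (hPp : Pp.PosDef) :
    (gaussZ Pp)⁻¹ * gaussZ Pm = ENNReal.ofReal (Real.sqrt (Pp.det / Pm.det)) := by
  obtain ⟨-, hZp0, hZptop⟩ := multivariateGaussian_inv_eq_withDensity hPp
  have hK := gaussZ_mul_sqrt_det_eq hPm hPp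
  have ha : 0 < Real.sqrt Pm.det := Real.sqrt_pos.2 hPm.det_pos
  have hb : 0 ≤ Real.sqrt Pp.det := Real.sqrt_nonneg _
  have ha0 : ENNReal.ofReal (Real.sqrt Pm.det) ≠ 0 := by
    rw [ENNReal.ofReal_ne_zero_iff]; exact ha
  have hZm : gaussZ Pm = gaussZ Pp * ENNReal.ofReal (Real.sqrt Pp.det) / ENNReal.ofReal (Real.sqrt Pm.det) := by
    rw [ENNReal.eq_div_iff ha0 ENNReal.ofReal_ne_top, mul_comm]
    exact hK
  rw [hZm, Real.sqrt_div' _ hPm.det_pos.le, ENNReal.ofReal_div_of_pos ha, mul_div_assoc, ← mul_assoc,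
    ENNReal.inv_mul_cancel hZp0 hZptop, one_mul]

/-- **Gaussian domination under an additive sandwich of precisions, upper**: if `⟨v,P₋v⟩ ≤ ⟨v,P₁v⟩ ≤ ⟨v,P₊v⟩` for positive definite
`P₋, P₁, P₊`, then for measurable `F ≥ 0`, `∫F dN(0,P₁⁻¹) ≤ √(det P₊/det P₋)·∫F dN(0,P₋⁻¹)`.
[cite: BenfattoEtAl1978, (5.13) p.155 (class substitute; ours)] -/
theorem lintegral_multivariateGaussian_le_of_sandwich {P₁ Pm Pp : Matrix ι ι ℝ} (hP₁ : P₁.PosDef) (hPm : Pm.PosDef)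
    (hPp : Pp.PosDef) (hlow : ∀ v : ι → ℝ, v ⬝ᵥ Pm *ᵥ v ≤ v ⬝ᵥ P₁ *ᵥ v)
    (hup : ∀ v : ι → ℝ, v ⬝ᵥ P₁ *ᵥ v ≤ v ⬝ᵥ Pp *ᵥ v) (F : EuclideanSpace ℝ ι → ℝ≥0∞) (hF : Measurable F) :
    ∫⁻ y, F y ∂(multivariateGaussian 0 P₁⁻¹) ≤
      ENNReal.ofReal (Real.sqrt (Pp.det / Pm.det)) * ∫⁻ y, F y ∂(multivariateGaussian 0 Pm⁻¹) := by
  have hw_up : ∀ y, gaussWeight P₁ y ≤ gaussWeight Pm y := by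
    intro y
    simp only [gaussWeight]
    apply ENNReal.ofReal_le_ofReal
    apply Real.exp_le_exp.2
    have := hlow (ofLp y)
    linarith
  have hw_low : ∀ y, gaussWeight Pp y ≤ gaussWeight P₁ y := by
    intro y
    simp only [gaussWeight]
    apply ENNReal.ofReal_le_ofReal
    apply Real.exp_le_exp.2
    have := hup (ofLp y)
    linarith
  have hZ : gaussZ Pp ≤ gaussZ P₁ := lintegral_mono hw_low
  have hI : ∫⁻ y, gaussWeight P₁ y * F y ≤ ∫⁻ y, gaussWeight Pm y * F y :=
    lintegral_mono fun y => mul_le_mul_left (hw_up y) _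
  rw [lintegral_multivariateGaussian_inv_eq hP₁ F hF, lintegral_multivariateGaussian_inv_eq hPm F hF, ← mul_assoc,
    ← gaussZ_inv_mul_gaussZ_eq hPm hPp, mul_assoc, mul_assoc]
  refine mul_le_mul' (ENNReal.inv_le_inv.2 hZ) ?_
  rw [← mul_assoc, ENNReal.mul_inv_cancel (multivariateGaussian_inv_eq_withDensity hPm).2.1
    (multivariateGaussian_inv_eq_withDensity hPm).2.2, one_mul]
  exact hI

/-- **Gaussian domination under an additive sandwich of precisions, lower**: `√(det P₋/det P₊)·∫F dN(0,P₊⁻¹) ≤ ∫F dN(0,P₁⁻¹)`.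
[cite: BenfattoEtAl1978, (5.13) p.155 (class substitute; ours)] -/
theorem lintegral_multivariateGaussian_ge_of_sandwich {P₁ Pm Pp : Matrix ι ι ℝ} (hP₁ : P₁.PosDef) (hPm : Pm.PosDef)
    (hPp : Pp.PosDef) (hlow : ∀ v : ι → ℝ, v ⬝ᵥ Pm *ᵥ v ≤ v ⬝ᵥ P₁ *ᵥ v)
    (hup : ∀ v : ι → ℝ, v ⬝ᵥ P₁ *ᵥ v ≤ v ⬝ᵥ Pp *ᵥ v) (F : EuclideanSpace ℝ ι → ℝ≥0∞) (hF : Measurable F) :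
    ENNReal.ofReal (Real.sqrt (Pm.det / Pp.det)) * ∫⁻ y, F y ∂(multivariateGaussian 0 Pp⁻¹) ≤
      ∫⁻ y, F y ∂(multivariateGaussian 0 P₁⁻¹) := by
  have hw_up : ∀ y, gaussWeight P₁ y ≤ gaussWeight Pm y := by
    intro y
    simp only [gaussWeight]
    apply ENNReal.ofReal_le_ofReal
    apply Real.exp_le_exp.2
    have := hlow (ofLp y)
    linarith
  have hw_low : ∀ y, gaussWeight Pp y ≤ gaussWeight P₁ y := by
    intro y
    simp only [gaussWeight]
    apply ENNReal.ofReal_le_ofReal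
    apply Real.exp_le_exp.2
    have := hup (ofLp y)
    linarith
  have hZ : gaussZ P₁ ≤ gaussZ Pm := lintegral_mono hw_up
  have hI : ∫⁻ y, gaussWeight Pp y * F y ≤ ∫⁻ y, gaussWeight P₁ y * F y :=
    lintegral_mono fun y => mul_le_mul_left (hw_low y) _
  rw [lintegral_multivariateGaussian_inv_eq hP₁ F hF, lintegral_multivariateGaussian_inv_eq hPp F hF, ← mul_assoc,
    ← gaussZ_inv_mul_gaussZ_eq hPp hPm, mul_assoc, mul_assoc]
  refine mul_le_mul' (ENNReal.inv_le_inv.2 hZ) ?_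
  rw [← mul_assoc, ENNReal.mul_inv_cancel (multivariateGaussian_inv_eq_withDensity hPp).2.1
    (multivariateGaussian_inv_eq_withDensity hPp).2.2, one_mul]
  exact hI

end Sandwich

/-! ## §3  The matrix part: position-dependent Schur test, the additive sandwich `B_bd − R ≤ B ≤ B_bd + R`, and the determinant ratio
`det(M + 2R)/det M ≤ exp(2Σ_y r_y/γ′)` -/

section MatrixPart

variable {m σ : Type*} [Fintype m] [DecidableEq m] [DecidableEq σ]

omit [DecidableEq m] in
/-- **Position-dependent Schur test**: if the cross rows of the symmetric `B` satisfy `Σ_{π y′ ≠ π y}|B y y′| ≤ r_y`, then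
`|Σ_{π y ≠ π y′} B y y′ x_y x_{y′}| ≤ Σ_y r_y x_y²` — the cross part is dominated by the DIAGONAL form `diag(r)`.
[cite: HornJohnson2013, §5.6 (Schur test; row-sum bound), position-dependent form] -/
theorem abs_form_cross_le_diag {B : Matrix m m ℝ} (hB : ∀ y y', B y y' = B y' y) (π : m → σ) (r : m → ℝ)
    (hr : ∀ y, ∑ y', (if π y = π y' then (0 : ℝ) else |B y y'|) ≤ r y) (x : m → ℝ) :
    |∑ y, ∑ y', (if π y = π y' then (0 : ℝ) else B y y') * x y * x y'| ≤ ∑ y, r y * x y ^ 2 := by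
  set w : m → m → ℝ := fun y y' => if π y = π y' then (0 : ℝ) else |B y y'| with hw
  have hwsymm : ∀ y y', w y y' = w y' y := by
    intro y y'
    simp only [hw]
    by_cases h : π y = π y'
    · rw [if_pos h, if_pos h.symm]
    · rw [if_neg h, if_neg (fun h' => h h'.symm), hB y y']
  have hterm : ∀ y y', |(if π y = π y' then (0 : ℝ) else B y y') * x y * x y'| ≤ w y y' * ((x y ^ 2 + x y' ^ 2) / 2) := by
    intro y y'
    simp only [hw]
    by_cases h : π y = π y'
    · rw [if_pos h, if_pos h]; simp
    · rw [if_neg h, if_neg h, abs_mul, abs_mul]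
      have hamgm : |x y| * |x y'| ≤ (x y ^ 2 + x y' ^ 2) / 2 := by
        nlinarith [sq_nonneg (|x y| - |x y'|), sq_abs (x y), sq_abs (x y')]
      calc |B y y'| * |x y| * |x y'| = |B y y'| * (|x y| * |x y'|) := by ring
        _ ≤ |B y y'| * ((x y ^ 2 + x y' ^ 2) / 2) := mul_le_mul_of_nonneg_left hamgm (abs_nonneg _)
  have hA1 : ∑ y, ∑ y', w y y' * x y ^ 2 ≤ ∑ y, r y * x y ^ 2 := by
    refine Finset.sum_le_sum fun y _ => ?_
    rw [← Finset.sum_mul]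
    exact mul_le_mul_of_nonneg_right (hr y) (sq_nonneg _)
  have hA2 : ∑ y, ∑ y', w y y' * x y' ^ 2 ≤ ∑ y, r y * x y ^ 2 := by
    rw [Finset.sum_comm]
    refine Finset.sum_le_sum fun y' _ => ?_
    rw [← Finset.sum_mul]
    refine mul_le_mul_of_nonneg_right ?_ (sq_nonneg _)
    calc ∑ y, w y y' = ∑ y, w y' y := Finset.sum_congr rfl fun y _ => hwsymm y y'
      _ ≤ r y' := hr y'
  have hsum : ∑ y, ∑ y', w y y' * ((x y ^ 2 + x y' ^ 2) / 2)
      = ((∑ y, ∑ y', w y y' * x y ^ 2) + ∑ y, ∑ y', w y y' * x y' ^ 2) / 2 := by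
    rw [← Finset.sum_add_distrib, Finset.sum_div]
    refine Finset.sum_congr rfl fun y _ => ?_
    rw [← Finset.sum_add_distrib, Finset.sum_div]
    refine Finset.sum_congr rfl fun y' _ => ?_
    ring
  calc |∑ y, ∑ y', (if π y = π y' then (0 : ℝ) else B y y') * x y * x y'|
      ≤ ∑ y, |∑ y', (if π y = π y' then (0 : ℝ) else B y y') * x y * x y'| := Finset.abs_sum_le_sum_abs _ _
    _ ≤ ∑ y, ∑ y', |(if π y = π y' then (0 : ℝ) else B y y') * x y * x y'| :=
        Finset.sum_le_sum fun y _ => Finset.abs_sum_le_sum_abs _ _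
    _ ≤ ∑ y, ∑ y', w y y' * ((x y ^ 2 + x y' ^ 2) / 2) :=
        Finset.sum_le_sum fun y _ => Finset.sum_le_sum fun y' _ => hterm y y'
    _ ≤ ∑ y, r y * x y ^ 2 := by rw [hsum]; linarith

/-- The quadratic form of `B_bd ± diag(r)` in `dotProduct` currency. [cite: HornJohnson2013, §0.7.2 (conformal partitions)] -/
theorem dot_blockDiag_add_diagonal (B : Matrix m m ℝ) (π : m → σ) (r : m → ℝ) (c : ℝ) (x : m → ℝ) :
    x ⬝ᵥ ((Matrix.of fun y y' => if π y = π y' then B y y' else 0) + c • Matrix.diagonal r) *ᵥ x =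
      (∑ y, ∑ y', (if π y = π y' then B y y' else 0) * x y * x y') + c * ∑ y, r y * x y ^ 2 := by
  rw [Matrix.add_mulVec, dotProduct_add, Matrix.smul_mulVec, dotProduct_smul, smul_eq_mul]
  congr 1
  · simp only [dotProduct, Matrix.mulVec, Matrix.of_apply, Finset.mul_sum]
    exact Finset.sum_congr rfl fun y _ => Finset.sum_congr rfl fun y' _ => by ring
  · congr 1
    simp only [dotProduct, Matrix.mulVec_diagonal]
    exact Finset.sum_congr rfl fun y _ => by ring

omit [DecidableEq m] in
/-- The quadratic form of `B` in `dotProduct` currency. [cite: HornJohnson2013, §0.7.2] -/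
private theorem dot_form_eq (B : Matrix m m ℝ) (x : m → ℝ) :
    x ⬝ᵥ B *ᵥ x = ∑ y, ∑ y', B y y' * x y * x y' := by
  simp only [dotProduct, Matrix.mulVec, Finset.mul_sum]
  exact Finset.sum_congr rfl fun y _ => Finset.sum_congr rfl fun y' _ => by ring

/-- **The additive sandwich**: with cross row sums `≤ r_y`, `⟨x,(B_bd − diag r)x⟩ ≤ ⟨x,Bx⟩ ≤ ⟨x,(B_bd + diag r)x⟩`.
[cite: BenfattoEtAl1978, (5.13) p.155 (class substitute; ours)] -/
theorem form_sandwich_blockDiag_diag {B : Matrix m m ℝ} (hB : ∀ y y', B y y' = B y' y) (π : m → σ) (r : m → ℝ)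
    (hr : ∀ y, ∑ y', (if π y = π y' then (0 : ℝ) else |B y y'|) ≤ r y) (x : m → ℝ) :
    x ⬝ᵥ ((Matrix.of fun y y' => if π y = π y' then B y y' else 0) + (-1 : ℝ) • Matrix.diagonal r) *ᵥ x ≤ x ⬝ᵥ B *ᵥ x ∧
      x ⬝ᵥ B *ᵥ x ≤ x ⬝ᵥ ((Matrix.of fun y y' => if π y = π y' then B y y' else 0) + (1 : ℝ) • Matrix.diagonal r) *ᵥ x := by
  rw [dot_blockDiag_add_diagonal, dot_blockDiag_add_diagonal, dot_form_eq, form_eq_blockDiag_add_cross B π x]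
  have h := abs_form_cross_le_diag hB π r hr x
  constructor
  · have := neg_abs_le (∑ y, ∑ y', (if π y = π y' then (0 : ℝ) else B y y') * x y * x y'); linarith
  · have := le_abs_self (∑ y, ∑ y', (if π y = π y' then (0 : ℝ) else B y y') * x y * x y'); linarith

/-- `B_bd − diag(r)` stays coercive with constant `γ − r_max`. [cite: HornJohnson2013, Thm 4.3.1 (Weyl; a diagonal perturbation shifts the
bottom of the spectrum by at most its size)] -/
theorem coercive_blockDiag_sub_diag {B : Matrix m m ℝ} [Fintype σ] (π : m → σ) {γ rmax : ℝ} (r : m → ℝ)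
    (hγ : ∀ x : m → ℝ, γ * ∑ y, x y ^ 2 ≤ ∑ y, ∑ y', B y y' * x y * x y') (hrmax : ∀ y, r y ≤ rmax) (x : m → ℝ) :
    (γ - rmax) * ∑ y, x y ^ 2 ≤
      ∑ y, ∑ y', ((Matrix.of fun y y' => if π y = π y' then B y y' else 0) + (-1 : ℝ) • Matrix.diagonal r) y y' * x y * x y' := by
  rw [← dot_form_eq, dot_blockDiag_add_diagonal]
  have h1 := coercive_blockDiag π hγ x
  have h2 : ∑ y, r y * x y ^ 2 ≤ rmax * ∑ y, x y ^ 2 := by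
    rw [Finset.mul_sum]
    exact Finset.sum_le_sum fun y _ => mul_le_mul_of_nonneg_right (hrmax y) (sq_nonneg _)
  nlinarith

/-- **The determinant ratio of a diagonal enlargement**: for a symmetric `γ′`-coercive `M` and `r ≥ 0`,
`det(M + diag(2r)) ≤ det(M)·exp(2Σ_y r_y/γ′)` — by the Weinstein–Aronszajn identity
`det(1 + M⁻¹D²) = det(1 + DM⁻¹D)` (`D = diag(√(2r))`, Mathlib `Matrix.det_one_add_mul_comm`), `ln det N ≤ tr N − n` for the positive definite
`N = 1 + DM⁻¹D` (the tree's `LogDet.log_det_le_gauss_node` at the node `t = 1`), and `(M⁻¹)_{yy} ≤ 1/γ′`.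
[cite: HornJohnson2013, §0.8.5 (Sylvester/Weinstein–Aronszajn determinant identity) with §7.1] -/
theorem det_add_diag_le_det_mul_exp {M : Matrix m m ℝ} (hM : ∀ y y', M y y' = M y' y) {γ' : ℝ} (hγ0 : 0 < γ')
    (hγ : ∀ x : m → ℝ, γ' * ∑ y, x y ^ 2 ≤ ∑ y, ∑ y', M y y' * x y * x y') (r : m → ℝ) (hr0 : ∀ y, 0 ≤ r y) :
    (M + Matrix.diagonal (fun y => 2 * r y)).det ≤ M.det * Real.exp (2 * ∑ y, r y / γ') := by
  have hMpd : M.PosDef := posDef_of_coercive hM hγ0 hγ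
  have hMu : IsUnit M.det := (Matrix.isUnit_iff_isUnit_det _).1 hMpd.isUnit
  set s : m → ℝ := fun y => Real.sqrt (2 * r y) with hs
  set D : Matrix m m ℝ := Matrix.diagonal s with hD
  have hDD : D * D = Matrix.diagonal (fun y => 2 * r y) := by
    rw [hD, Matrix.diagonal_mul_diagonal]
    congr 1
    funext y
    simp only [hs]
    rw [← sq, Real.sq_sqrt (by have := hr0 y; positivity)]
  -- factor `M + D² = M(1 + M⁻¹D²)`
  have hfac : M + Matrix.diagonal (fun y => 2 * r y) = M * (1 + M⁻¹ * D * D) := by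
    rw [Matrix.mul_add, Matrix.mul_one, ← Matrix.mul_assoc, ← Matrix.mul_assoc, Matrix.mul_nonsing_inv M hMu,
      Matrix.one_mul, hDD]
  -- Weinstein–Aronszajn
  set N : Matrix m m ℝ := 1 + D * M⁻¹ * D with hN
  have hWA : (1 + M⁻¹ * D * D).det = N.det := by
    rw [hN, Matrix.mul_assoc D, ← Matrix.det_one_add_mul_comm (M⁻¹ * D) D]
  -- `N` is positive definite: `⟨x,Nx⟩ = ‖x‖² + ⟨Dx, M⁻¹Dx⟩`
  have hMinv : M⁻¹.PosDef := hMpd.inv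
  have hMi : ∀ a b, M⁻¹ a b = M⁻¹ b a := fun a b => by
    have h := hMinv.isHermitian.apply a b
    simpa using h.symm
  have hDMD : ∀ y y', (D * M⁻¹ * D) y y' = s y * M⁻¹ y y' * s y' := by
    intro y y'
    rw [hD, Matrix.mul_diagonal, Matrix.diagonal_mul]
  have hNsymm : ∀ y y', N y y' = N y' y := by
    intro y y'
    rw [hN, Matrix.add_apply, Matrix.add_apply, hDMD, hDMD, hMi y y', Matrix.one_apply, Matrix.one_apply]
    by_cases h : y = y'
    · subst h; rfl
    · rw [if_neg h, if_neg (Ne.symm h)]; ring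
  have hNcoer : ∀ x : m → ℝ, 1 * ∑ y, x y ^ 2 ≤ ∑ y, ∑ y', N y y' * x y * x y' := by
    intro x
    rw [← dot_form_eq, hN, Matrix.add_mulVec, dotProduct_add, Matrix.one_mulVec, one_mul]
    have hsq : x ⬝ᵥ x = ∑ y, x y ^ 2 := by simp only [dotProduct]; exact Finset.sum_congr rfl fun y _ => by ring
    rw [hsq]
    have hpsd : 0 ≤ x ⬝ᵥ (D * M⁻¹ * D) *ᵥ x := by
      have hDt : Dᵀ = D := Matrix.diagonal_transpose s
      have h1 : (D * M⁻¹ * D) *ᵥ x = D *ᵥ (M⁻¹ *ᵥ (D *ᵥ x)) := by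
        rw [← Matrix.mulVec_mulVec, ← Matrix.mulVec_mulVec]
      rw [h1, Matrix.dotProduct_mulVec, ← Matrix.mulVec_transpose, hDt]
      have h := hMinv.posSemidef.dotProduct_mulVec_nonneg (D *ᵥ x)
      simpa using h
    linarith
  have hNpd : N.PosDef := posDef_of_coercive hNsymm one_pos hNcoer
  -- `ln det N ≤ tr N − n = Σ 2 r_y (M⁻¹)_yy ≤ 2Σ r_y/γ′`
  have hlog := Literature.Analysis.Matrix.LogDet.log_det_le_gauss_node hNpd one_pos
  rw [Real.log_one, mul_zero, zero_add, div_one] at hlog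
  have hNdiag : ∀ y, N y y = 1 + 2 * r y * M⁻¹ y y := by
    intro y
    rw [hN, Matrix.add_apply, hDMD, Matrix.one_apply_eq]
    have h2 : s y * M⁻¹ y y * s y = (s y * s y) * M⁻¹ y y := by ring
    rw [h2]
    simp only [hs]
    rw [Real.mul_self_sqrt (by have := hr0 y; positivity)]
  have htr : N.trace = Fintype.card m + ∑ y, 2 * r y * M⁻¹ y y := by
    simp only [Matrix.trace, Matrix.diag_apply, hNdiag, Finset.sum_add_distrib, Finset.sum_const, Finset.card_univ,
      nsmul_eq_mul, mul_one]
  have hdiag : ∀ y, M⁻¹ y y ≤ 1 / γ' := fun y => (inv_apply_self_pos_le hM hγ0 hγ y).2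
  have htr_le : N.trace - Fintype.card m ≤ 2 * ∑ y, r y / γ' := by
    rw [htr, add_sub_cancel_left, Finset.mul_sum]
    refine Finset.sum_le_sum fun y _ => ?_
    have := hdiag y; have := hr0 y
    calc 2 * r y * M⁻¹ y y ≤ 2 * r y * (1 / γ') := mul_le_mul_of_nonneg_left (hdiag y) (by positivity)
      _ = 2 * (r y / γ') := by ring
  have hdetN : N.det ≤ Real.exp (2 * ∑ y, r y / γ') := by
    have h1 : Real.log N.det ≤ 2 * ∑ y, r y / γ' := by linarith
    calc N.det = Real.exp (Real.log N.det) := (Real.exp_log hNpd.det_pos).symm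
      _ ≤ Real.exp (2 * ∑ y, r y / γ') := Real.exp_le_exp.2 h1
  rw [hfac, Matrix.det_mul, hWA]
  exact mul_le_mul_of_nonneg_left hdetN hMpd.det_pos.le

end MatrixPart

/-! ## §4  The |I|-extensive decoupling estimate -/

section Extensive

open Literature.MathematicalPhysics.QuantumFieldTheory.Balaban1983to89.B1Eq324BenfattoClassMarkov

variable {m σ : Type*} [Fintype m] [DecidableEq m] [Fintype σ] [DecidableEq σ]

/-- **THE |I|-EXTENSIVE DECOUPLING ESTIMATE (precision form).**  Let `B` be a symmetric `γ`-coercive precision on the finite index set `m`,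
`π : m → σ` a partition, and `r : m → ℝ` a bound on the CROSS row sums, `Σ_{π y′ ≠ π y}|B y y′| ≤ r_y ≤ r_max < γ`.  With the block-diagonal
part `B_bd` and `R = diag(r)`: both `B_bd ∓ R` are positive definite (coercive with `γ − r_max`), `⟨x,(B_bd − R)x⟩ ≤ ⟨x,Bx⟩ ≤ ⟨x,(B_bd + R)x⟩`, and
for every measurable `F ≥ 0`, with `ρ := (Σ_y r_y)/(γ − r_max)`,
`e^{−ρ}∫F dN(0,(B_bd + R)⁻¹) ≤ ∫F dN(0,B⁻¹) ≤ e^{ρ}∫F dN(0,(B_bd − R)⁻¹)`.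
The comparison precisions `B_bd ∓ R` are STILL block-diagonal (independent parts), each part `B|_p ∓ R|_p` coercive with `γ − r_max` and with
the SAME Combes–Thomas defect rows as `B` (a diagonal shift has weight zero), and the prefactor is extensive in the CROSS MASS `Σ_y r_y` — for a
`w`-separated partition `r_y ≤ Σ_{dist(y,y′) ≥ w}|B y y′|` is exponentially small in `w` AND in the distance of `y` to the other parts, so
`Σ_y r_y` is carried by the corridor-adjacent sites only (the volume factor of `B1Eq324BenfattoClassDecoupling.decoupling` removed).
[cite: BenfattoEtAl1978, (5.13) p.155 (class substitute; ours)] -/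
theorem decoupling_extensive {B : Matrix m m ℝ} (hB : ∀ y y', B y y' = B y' y) (π : m → σ) {γ rmax : ℝ} (r : m → ℝ)
    (hγ : ∀ x : m → ℝ, γ * ∑ y, x y ^ 2 ≤ ∑ y, ∑ y', B y y' * x y * x y')
    (hr : ∀ y, ∑ y', (if π y = π y' then (0 : ℝ) else |B y y'|) ≤ r y) (hrmax : ∀ y, r y ≤ rmax) (hγr : rmax < γ)
    (F : EuclideanSpace ℝ m → ℝ≥0∞) (hF : Measurable F) :
    let Bbd : Matrix m m ℝ := Matrix.of fun y y' => if π y = π y' then B y y' else 0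
    let ρ : ℝ := (∑ y, r y) / (γ - rmax)
    (Bbd - Matrix.diagonal r).PosDef ∧ (Bbd + Matrix.diagonal r).PosDef ∧
      (∀ x : m → ℝ, x ⬝ᵥ (Bbd - Matrix.diagonal r) *ᵥ x ≤ x ⬝ᵥ B *ᵥ x ∧
        x ⬝ᵥ B *ᵥ x ≤ x ⬝ᵥ (Bbd + Matrix.diagonal r) *ᵥ x) ∧
      ENNReal.ofReal (Real.exp (-ρ)) * ∫⁻ y, F y ∂(multivariateGaussian 0 (Bbd + Matrix.diagonal r)⁻¹) ≤
          ∫⁻ y, F y ∂(multivariateGaussian 0 B⁻¹) ∧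
      ∫⁻ y, F y ∂(multivariateGaussian 0 B⁻¹) ≤
        ENNReal.ofReal (Real.exp ρ) * ∫⁻ y, F y ∂(multivariateGaussian 0 (Bbd - Matrix.diagonal r)⁻¹) := by
  intro Bbd ρ
  have hγ' : 0 < γ - rmax := by linarith
  have hr0 : ∀ y, 0 ≤ r y := fun y => le_trans (Finset.sum_nonneg fun y' _ => by
    split_ifs
    · exact le_rfl
    · exact abs_nonneg _) (hr y)
  -- notation bridges
  have hPm_eq : Bbd - Matrix.diagonal r = Bbd + (-1 : ℝ) • Matrix.diagonal r := by rw [neg_one_smul, sub_eq_add_neg]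
  have hPp_eq : Bbd + Matrix.diagonal r = Bbd + (1 : ℝ) • Matrix.diagonal r := by rw [one_smul]
  have hform : ∀ (M : Matrix m m ℝ) (x : m → ℝ), x ⬝ᵥ M *ᵥ x = ∑ y, ∑ y', M y y' * x y * x y' := fun M x => by
    simp only [dotProduct, Matrix.mulVec, Finset.mul_sum]
    exact Finset.sum_congr rfl fun y _ => Finset.sum_congr rfl fun y' _ => by ring
  -- symmetry of the comparison precisions
  have hBbd_symm : ∀ y y', Bbd y y' = Bbd y' y := by
    intro y y'
    simp only [Bbd, Matrix.of_apply]
    by_cases h : π y = π y'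
    · rw [if_pos h, if_pos h.symm, hB y y']
    · rw [if_neg h, if_neg (fun h' => h h'.symm)]
  have hdiag_symm : ∀ y y', Matrix.diagonal r y y' = Matrix.diagonal r y' y := fun y y' => by
    rw [← Matrix.diagonal_transpose, Matrix.transpose_apply, Matrix.diagonal_transpose]
  have hPm_symm : ∀ y y', (Bbd - Matrix.diagonal r) y y' = (Bbd - Matrix.diagonal r) y' y := fun y y' => by
    rw [Matrix.sub_apply, Matrix.sub_apply, hBbd_symm, hdiag_symm]
  have hPp_symm : ∀ y y', (Bbd + Matrix.diagonal r) y y' = (Bbd + Matrix.diagonal r) y' y := fun y y' => by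
    rw [Matrix.add_apply, Matrix.add_apply, hBbd_symm, hdiag_symm]
  -- the sandwich
  have hsand : ∀ x : m → ℝ, x ⬝ᵥ (Bbd - Matrix.diagonal r) *ᵥ x ≤ x ⬝ᵥ B *ᵥ x ∧
      x ⬝ᵥ B *ᵥ x ≤ x ⬝ᵥ (Bbd + Matrix.diagonal r) *ᵥ x := by
    intro x
    rw [hPm_eq, hPp_eq]
    exact form_sandwich_blockDiag_diag hB π r hr x
  -- coercivity of the comparison precisions with `γ − r_max`
  have hPm_coer : ∀ x : m → ℝ, (γ - rmax) * ∑ y, x y ^ 2 ≤ ∑ y, ∑ y', (Bbd - Matrix.diagonal r) y y' * x y * x y' := by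
    intro x
    rw [hPm_eq]
    exact coercive_blockDiag_sub_diag π r hγ hrmax x
  have hPp_coer : ∀ x : m → ℝ, (γ - rmax) * ∑ y, x y ^ 2 ≤ ∑ y, ∑ y', (Bbd + Matrix.diagonal r) y y' * x y * x y' := by
    intro x
    have h1 := hPm_coer x
    have h2 := (hsand x)
    rw [← hform] at h1 ⊢
    linarith [h2.1, h2.2]
  have hPm : (Bbd - Matrix.diagonal r).PosDef := posDef_of_coercive hPm_symm hγ' hPm_coer
  have hPp : (Bbd + Matrix.diagonal r).PosDef := posDef_of_coercive hPp_symm hγ' hPp_coer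
  have hBγ0 : 0 < γ ∨ IsEmpty m := by
    rcases isEmpty_or_nonempty m with hm | hm
    · exact Or.inr hm
    · exact Or.inl (lt_of_le_of_lt (le_trans (hr0 (Classical.arbitrary m)) (hrmax _)) hγr)
  have hBpd : B.PosDef := by
    rcases hBγ0 with hγ0 | hm
    · exact posDef_of_coercive hB hγ0 hγ
    · -- no index: every matrix on an empty type is positive definite
      refine Matrix.PosDef.of_dotProduct_mulVec_pos (Matrix.IsHermitian.ext fun i j => (IsEmpty.false i).elim) fun x hx => ?_
      exact absurd (funext fun i => (IsEmpty.false i).elim) hx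
  -- the determinant ratio
  have hPp_split : Bbd + Matrix.diagonal r = (Bbd - Matrix.diagonal r) + Matrix.diagonal (fun y => 2 * r y) := by
    ext y y'
    simp only [Matrix.add_apply, Matrix.sub_apply, Matrix.diagonal_apply]
    split_ifs <;> ring
  have hdet : (Bbd + Matrix.diagonal r).det ≤ (Bbd - Matrix.diagonal r).det * Real.exp (2 * ρ) := by
    rw [hPp_split, show 2 * ρ = 2 * ∑ y, r y / (γ - rmax) by
      simp only [ρ]; rw [Finset.sum_div]]
    exact det_add_diag_le_det_mul_exp hPm_symm hγ' hPm_coer r hr0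
  have hdm : 0 < (Bbd - Matrix.diagonal r).det := hPm.det_pos
  have hdp : 0 < (Bbd + Matrix.diagonal r).det := hPp.det_pos
  have hsq_up : Real.sqrt ((Bbd + Matrix.diagonal r).det / (Bbd - Matrix.diagonal r).det) ≤ Real.exp ρ := by
    have h1 : (Bbd + Matrix.diagonal r).det / (Bbd - Matrix.diagonal r).det ≤ Real.exp ρ ^ 2 := by
      rw [div_le_iff₀ hdm, ← Real.exp_nat_mul]
      push_cast
      linarith
    calc Real.sqrt ((Bbd + Matrix.diagonal r).det / (Bbd - Matrix.diagonal r).det) ≤ Real.sqrt (Real.exp ρ ^ 2) :=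
          Real.sqrt_le_sqrt h1
      _ = Real.exp ρ := Real.sqrt_sq (Real.exp_pos _).le
  have hsq_low : Real.exp (-ρ) ≤ Real.sqrt ((Bbd - Matrix.diagonal r).det / (Bbd + Matrix.diagonal r).det) := by
    have h1 : Real.exp (-ρ) ^ 2 ≤ (Bbd - Matrix.diagonal r).det / (Bbd + Matrix.diagonal r).det := by
      rw [le_div_iff₀ hdp, ← Real.exp_nat_mul]
      push_cast
      have h2 : Real.exp (2 * -ρ) * ((Bbd - Matrix.diagonal r).det * Real.exp (2 * ρ)) =
          (Bbd - Matrix.diagonal r).det := by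
        rw [mul_comm, mul_assoc, ← Real.exp_add]; simp
      calc Real.exp (2 * -ρ) * (Bbd + Matrix.diagonal r).det
          ≤ Real.exp (2 * -ρ) * ((Bbd - Matrix.diagonal r).det * Real.exp (2 * ρ)) :=
            mul_le_mul_of_nonneg_left hdet (Real.exp_pos _).le
        _ = (Bbd - Matrix.diagonal r).det := h2
    calc Real.exp (-ρ) = Real.sqrt (Real.exp (-ρ) ^ 2) := (Real.sqrt_sq (Real.exp_pos _).le).symm
      _ ≤ _ := Real.sqrt_le_sqrt h1
  refine ⟨hPm, hPp, hsand, ?_, ?_⟩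
  · calc ENNReal.ofReal (Real.exp (-ρ)) * ∫⁻ y, F y ∂(multivariateGaussian 0 (Bbd + Matrix.diagonal r)⁻¹)
        ≤ ENNReal.ofReal (Real.sqrt ((Bbd - Matrix.diagonal r).det / (Bbd + Matrix.diagonal r).det)) *
            ∫⁻ y, F y ∂(multivariateGaussian 0 (Bbd + Matrix.diagonal r)⁻¹) :=
          mul_le_mul_left (ENNReal.ofReal_le_ofReal hsq_low) _
      _ ≤ ∫⁻ y, F y ∂(multivariateGaussian 0 B⁻¹) :=
          lintegral_multivariateGaussian_ge_of_sandwich hBpd hPm hPp (fun v => (hsand v).1) (fun v => (hsand v).2) F hF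
  · calc ∫⁻ y, F y ∂(multivariateGaussian 0 B⁻¹)
        ≤ ENNReal.ofReal (Real.sqrt ((Bbd + Matrix.diagonal r).det / (Bbd - Matrix.diagonal r).det)) *
            ∫⁻ y, F y ∂(multivariateGaussian 0 (Bbd - Matrix.diagonal r)⁻¹) :=
          lintegral_multivariateGaussian_le_of_sandwich hBpd hPm hPp (fun v => (hsand v).1) (fun v => (hsand v).2) F hF
      _ ≤ ENNReal.ofReal (Real.exp ρ) * ∫⁻ y, F y ∂(multivariateGaussian 0 (Bbd - Matrix.diagonal r)⁻¹) :=
          mul_le_mul_left (ENNReal.ofReal_le_ofReal hsq_up) _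

omit [Fintype σ] in
/-- **The comparison precisions are block-diagonal**: `(B_bd ± diag(r))⁻¹` has no entries across the partition, so under
`N(m, (B_bd ± diag r)⁻¹)` the parts are uncorrelated (independent by the generic Gaussian layer). [cite: BenfattoEtAl1978, (5.13) p.155
(class substitute; ours)] -/
theorem inv_blockDiag_add_smul_diagonal_apply_eq_zero {B : Matrix m m ℝ} (π : m → σ) (r : m → ℝ) (c : ℝ)
    (hPD : ((Matrix.of fun y y' => if π y = π y' then B y y' else 0 : Matrix m m ℝ) + c • Matrix.diagonal r).PosDef)
    {y y' : m} (hyy' : π y ≠ π y') :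
    ((Matrix.of fun y y' => if π y = π y' then B y y' else 0 : Matrix m m ℝ) + c • Matrix.diagonal r)⁻¹ y y' = 0 := by
  have hdet := (Matrix.isUnit_iff_isUnit_det _).mp hPD.isUnit
  refine inv_apply_eq_zero_of_separated hdet (fun a => π a = π y) (fun z w hzw => ?_) (fun h => hyy' (h.mp rfl).symm)
  have hne : π z ≠ π w := fun h => hzw (by rw [h])
  have hzw' : z ≠ w := fun h => hne (by rw [h])
  simp only [Matrix.add_apply, Matrix.of_apply, if_neg hne, Matrix.smul_apply, Matrix.diagonal_apply_ne _ hzw', smul_zero,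
    add_zero]

/-- **The |I|-extensive decoupling at the conditional precision of the class** (`B = A|_{Γᶜ}`, uniform in `Γ`): for `A` symmetric and
`γ`-coercive, a conditioning set `Γ`, a partition `π` of `Γᶜ` and cross-row-sum bounds `r` on `Γᶜ` with `r ≤ r_max < γ`, the five conclusions of
`decoupling_extensive` hold for `A|_{Γᶜ}` (whose inverse is the conditional covariance `C^Γ`). [cite: BenfattoEtAl1978, (5.13) p.155 (class
substitute; ours)] -/
theorem decoupling_extensive_conditional {ι : Type*} [Fintype ι] [DecidableEq ι] {A : Matrix ι ι ℝ} (hA : ∀ e e', A e e' = A e' e)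
    {γ rmax : ℝ} (hγ : ∀ x : ι → ℝ, γ * ∑ e, x e ^ 2 ≤ ∑ e, ∑ e', A e e' * x e * x e')
    (Γ : Finset ι) (π : ↥Γᶜ → σ) (r : ↥Γᶜ → ℝ)
    (hr : ∀ y : ↥Γᶜ, ∑ y' : ↥Γᶜ, (if π y = π y' then (0 : ℝ) else |A y y'|) ≤ r y) (hrmax : ∀ y, r y ≤ rmax) (hγr : rmax < γ)
    (F : EuclideanSpace ℝ ↥Γᶜ → ℝ≥0∞) (hF : Measurable F) :
    let B : Matrix ↥Γᶜ ↥Γᶜ ℝ := A.submatrix (fun j : ↥Γᶜ => (j : ι)) (fun j : ↥Γᶜ => (j : ι))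
    let Bbd : Matrix ↥Γᶜ ↥Γᶜ ℝ := Matrix.of fun y y' => if π y = π y' then B y y' else 0
    let ρ : ℝ := (∑ y, r y) / (γ - rmax)
    (Bbd - Matrix.diagonal r).PosDef ∧ (Bbd + Matrix.diagonal r).PosDef ∧
      (∀ x : ↥Γᶜ → ℝ, x ⬝ᵥ (Bbd - Matrix.diagonal r) *ᵥ x ≤ x ⬝ᵥ B *ᵥ x ∧
        x ⬝ᵥ B *ᵥ x ≤ x ⬝ᵥ (Bbd + Matrix.diagonal r) *ᵥ x) ∧
      ENNReal.ofReal (Real.exp (-ρ)) * ∫⁻ y, F y ∂(multivariateGaussian 0 (Bbd + Matrix.diagonal r)⁻¹) ≤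
          ∫⁻ y, F y ∂(multivariateGaussian 0 B⁻¹) ∧
      ∫⁻ y, F y ∂(multivariateGaussian 0 B⁻¹) ≤
        ENNReal.ofReal (Real.exp ρ) * ∫⁻ y, F y ∂(multivariateGaussian 0 (Bbd - Matrix.diagonal r)⁻¹) := by
  intro B Bbd ρ
  have hBsymm : ∀ y y' : ↥Γᶜ, B y y' = B y' y := fun y y' => hA y y'
  have hBγ : ∀ x : ↥Γᶜ → ℝ, γ * ∑ y, x y ^ 2 ≤ ∑ y, ∑ y', B y y' * x y * x y' := coercive_submatrix hγ Γᶜ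
  exact decoupling_extensive hBsymm π r hBγ hr hrmax hγr F hF


omit [Fintype σ] in
/-- **The comparison precisions keep the Combes–Thomas defect rows of `B`**: for a weight vanishing on the diagonal (`dist y y = 0`), the
`cosh`-defect row of `B_bd + c·diag(r)` at `y` is at most that of `B` (entries: a subset of `B`'s off the diagonal, the diagonal carrying weight
zero) — so each part of `B_bd ∓ diag(r)` is in the class of `B1Eq324BenfattoClassAppendixC` with `γ ↦ γ − r_max` and the SAME `J`.
[cite: BenfattoEtAl1978, (5.13) p.155 (class substitute; ours)] -/
theorem rowDefect_blockDiag_add_smul_diagonal_le {B : Matrix m m ℝ} (π : m → σ) (r : m → ℝ) (c : ℝ) {dist : m → m → ℝ}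
    {κ : ℝ} (hd0 : ∀ y, dist y y = 0) (y : m) :
    ∑ y', |((Matrix.of fun a b => if π a = π b then B a b else 0 : Matrix m m ℝ) + c • Matrix.diagonal r) y y'| *
        (Real.cosh (κ * dist y y') - 1) ≤
      ∑ y', |B y y'| * (Real.cosh (κ * dist y y') - 1) := by
  refine Finset.sum_le_sum fun y' _ => ?_
  have hc0 : 0 ≤ Real.cosh (κ * dist y y') - 1 := by linarith [Real.one_le_cosh (κ * dist y y')]
  by_cases hyy : y = y'
  · subst hyy
    rw [hd0, mul_zero, Real.cosh_zero, sub_self, mul_zero, mul_zero]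
  · refine mul_le_mul_of_nonneg_right ?_ hc0
    simp only [Matrix.add_apply, Matrix.of_apply, Matrix.smul_apply, Matrix.diagonal_apply_ne _ hyy, smul_zero, add_zero]
    split_ifs
    · exact le_rfl
    · rw [abs_zero]; exact abs_nonneg _

end Extensive

/-! ## §5 (v1.1, APPEND-ONLY)  Common-mean editions: the additive sandwich domination and the extensive decoupling for `N(u, ·)` —
the (5.13)-substitute is applied to the NON-centred conditional law `N(u_Γ(ξ), C^Γ)`; the centre rides along (translate `F`) -/

section Mean

variable {ι : Type*} [Fintype ι] [DecidableEq ι]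

/-- **Additive-sandwich domination with a common mean, upper**: if `⟨v,P₋v⟩ ≤ ⟨v,P₁v⟩ ≤ ⟨v,P₊v⟩` for positive definite `P₋, P₁, P₊`, then
for every centre `u` and measurable `F ≥ 0`, `∫F dN(u,P₁⁻¹) ≤ √(det P₊/det P₋)·∫F dN(u,P₋⁻¹)` (translate of
`lintegral_multivariateGaussian_le_of_sandwich` by `B1Eq324BenfattoClassDecoupling.multivariateGaussian_eq_map_add`).
[cite: BenfattoEtAl1978, (5.13) p.155 (class substitute; ours)] -/
theorem lintegral_multivariateGaussian_mean_le_of_sandwich {P₁ Pm Pp : Matrix ι ι ℝ} (hP₁ : P₁.PosDef) (hPm : Pm.PosDef)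
    (hPp : Pp.PosDef) (hlow : ∀ v : ι → ℝ, v ⬝ᵥ Pm *ᵥ v ≤ v ⬝ᵥ P₁ *ᵥ v)
    (hup : ∀ v : ι → ℝ, v ⬝ᵥ P₁ *ᵥ v ≤ v ⬝ᵥ Pp *ᵥ v) (u : EuclideanSpace ℝ ι)
    (F : EuclideanSpace ℝ ι → ℝ≥0∞) (hF : Measurable F) :
    ∫⁻ y, F y ∂(multivariateGaussian u P₁⁻¹) ≤
      ENNReal.ofReal (Real.sqrt (Pp.det / Pm.det)) * ∫⁻ y, F y ∂(multivariateGaussian u Pm⁻¹) := by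
  rw [multivariateGaussian_eq_map_add u P₁⁻¹, multivariateGaussian_eq_map_add u Pm⁻¹,
    lintegral_map hF (measurable_const_add u), lintegral_map hF (measurable_const_add u)]
  exact lintegral_multivariateGaussian_le_of_sandwich hP₁ hPm hPp hlow hup (fun x => F (u + x))
    (hF.comp (measurable_const_add u))

/-- **Additive-sandwich domination with a common mean, lower**: `√(det P₋/det P₊)·∫F dN(u,P₊⁻¹) ≤ ∫F dN(u,P₁⁻¹)`.
[cite: BenfattoEtAl1978, (5.13) p.155 (class substitute; ours)] -/
theorem lintegral_multivariateGaussian_mean_ge_of_sandwich {P₁ Pm Pp : Matrix ι ι ℝ} (hP₁ : P₁.PosDef) (hPm : Pm.PosDef)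
    (hPp : Pp.PosDef) (hlow : ∀ v : ι → ℝ, v ⬝ᵥ Pm *ᵥ v ≤ v ⬝ᵥ P₁ *ᵥ v)
    (hup : ∀ v : ι → ℝ, v ⬝ᵥ P₁ *ᵥ v ≤ v ⬝ᵥ Pp *ᵥ v) (u : EuclideanSpace ℝ ι)
    (F : EuclideanSpace ℝ ι → ℝ≥0∞) (hF : Measurable F) :
    ENNReal.ofReal (Real.sqrt (Pm.det / Pp.det)) * ∫⁻ y, F y ∂(multivariateGaussian u Pp⁻¹) ≤
      ∫⁻ y, F y ∂(multivariateGaussian u P₁⁻¹) := by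
  rw [multivariateGaussian_eq_map_add u P₁⁻¹, multivariateGaussian_eq_map_add u Pp⁻¹,
    lintegral_map hF (measurable_const_add u), lintegral_map hF (measurable_const_add u)]
  exact lintegral_multivariateGaussian_ge_of_sandwich hP₁ hPm hPp hlow hup (fun x => F (u + x))
    (hF.comp (measurable_const_add u))

end Mean

section ExtensiveMean

variable {m σ : Type*} [Fintype m] [DecidableEq m] [Fintype σ] [DecidableEq σ]

/-- **The |I|-extensive decoupling with a COMMON CENTRE** (the two integral conclusions of `decoupling_extensive` for `N(u, ·)`): with
`B_bd`, `R = diag(r)`, `ρ = (Σ_y r_y)/(γ − r_max)` as there and any centre `u`,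
`e^{−ρ}∫F dN(u,(B_bd + R)⁻¹) ≤ ∫F dN(u,B⁻¹) ≤ e^{ρ}∫F dN(u,(B_bd − R)⁻¹)` — the form in which the substitute meets the conditional law
`N(u_Γ(ξ), C^Γ)` of [BenfattoEtAl1978] §5 (centre = the regression `u_Γ(ξ)` of `B1Eq324BenfattoClassAppendixC.regression_apply_eq`); each
box marginal of the comparison measures is then `N(u|_p,(B|_p ∓ diag r|_p)⁻¹)` (sequel `B1Eq324BenfattoClassComparisonBoxes`).
[cite: BenfattoEtAl1978, (5.13) p.155 (class substitute; ours)] -/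
theorem decoupling_extensive_mean {B : Matrix m m ℝ} (hB : ∀ y y', B y y' = B y' y) (π : m → σ) {γ rmax : ℝ} (r : m → ℝ)
    (hγ : ∀ x : m → ℝ, γ * ∑ y, x y ^ 2 ≤ ∑ y, ∑ y', B y y' * x y * x y')
    (hr : ∀ y, ∑ y', (if π y = π y' then (0 : ℝ) else |B y y'|) ≤ r y) (hrmax : ∀ y, r y ≤ rmax) (hγr : rmax < γ)
    (u : EuclideanSpace ℝ m) (F : EuclideanSpace ℝ m → ℝ≥0∞) (hF : Measurable F) :
    let Bbd : Matrix m m ℝ := Matrix.of fun y y' => if π y = π y' then B y y' else 0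
    let ρ : ℝ := (∑ y, r y) / (γ - rmax)
    ENNReal.ofReal (Real.exp (-ρ)) * ∫⁻ y, F y ∂(multivariateGaussian u (Bbd + Matrix.diagonal r)⁻¹) ≤
        ∫⁻ y, F y ∂(multivariateGaussian u B⁻¹) ∧
      ∫⁻ y, F y ∂(multivariateGaussian u B⁻¹) ≤
        ENNReal.ofReal (Real.exp ρ) * ∫⁻ y, F y ∂(multivariateGaussian u (Bbd - Matrix.diagonal r)⁻¹) := by
  intro Bbd ρ
  obtain ⟨-, -, -, h1, h2⟩ :=
    decoupling_extensive hB π r hγ hr hrmax hγr (fun x => F (u + x)) (hF.comp (measurable_const_add u))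
  rw [multivariateGaussian_eq_map_add u B⁻¹, multivariateGaussian_eq_map_add u (Bbd + Matrix.diagonal r)⁻¹,
    multivariateGaussian_eq_map_add u (Bbd - Matrix.diagonal r)⁻¹,
    lintegral_map hF (measurable_const_add u), lintegral_map hF (measurable_const_add u),
    lintegral_map hF (measurable_const_add u)]
  exact ⟨h1, h2⟩

/-- **The |I|-extensive decoupling with a common centre at the conditional precision of the class** (`B = A|_{Γᶜ}`, uniform in `Γ`; the
two integral conclusions of `decoupling_extensive_conditional` for `N(u, ·)`). [cite: BenfattoEtAl1978, (5.13) p.155 (class substitute; ours)] -/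
theorem decoupling_extensive_conditional_mean {ι : Type*} [Fintype ι] [DecidableEq ι] {A : Matrix ι ι ℝ}
    (hA : ∀ e e', A e e' = A e' e) {γ rmax : ℝ} (hγ : ∀ x : ι → ℝ, γ * ∑ e, x e ^ 2 ≤ ∑ e, ∑ e', A e e' * x e * x e')
    (Γ : Finset ι) (π : ↥Γᶜ → σ) (r : ↥Γᶜ → ℝ)
    (hr : ∀ y : ↥Γᶜ, ∑ y' : ↥Γᶜ, (if π y = π y' then (0 : ℝ) else |A y y'|) ≤ r y) (hrmax : ∀ y, r y ≤ rmax) (hγr : rmax < γ)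
    (u : EuclideanSpace ℝ ↥Γᶜ) (F : EuclideanSpace ℝ ↥Γᶜ → ℝ≥0∞) (hF : Measurable F) :
    let B : Matrix ↥Γᶜ ↥Γᶜ ℝ := A.submatrix (fun j : ↥Γᶜ => (j : ι)) (fun j : ↥Γᶜ => (j : ι))
    let Bbd : Matrix ↥Γᶜ ↥Γᶜ ℝ := Matrix.of fun y y' => if π y = π y' then B y y' else 0
    let ρ : ℝ := (∑ y, r y) / (γ - rmax)
    ENNReal.ofReal (Real.exp (-ρ)) * ∫⁻ y, F y ∂(multivariateGaussian u (Bbd + Matrix.diagonal r)⁻¹) ≤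
        ∫⁻ y, F y ∂(multivariateGaussian u B⁻¹) ∧
      ∫⁻ y, F y ∂(multivariateGaussian u B⁻¹) ≤
        ENNReal.ofReal (Real.exp ρ) * ∫⁻ y, F y ∂(multivariateGaussian u (Bbd - Matrix.diagonal r)⁻¹) := by
  intro B Bbd ρ
  have hBsymm : ∀ y y' : ↥Γᶜ, B y y' = B y' y := fun y y' => hA y y'
  have hBγ : ∀ x : ↥Γᶜ → ℝ, γ * ∑ y, x y ^ 2 ≤ ∑ y, ∑ y', B y y' * x y * x y' := coercive_submatrix hγ Γᶜ
  exact decoupling_extensive_mean hBsymm π r hBγ hr hrmax hγr u F hF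


/-- **The determinant ratio of the two comparison precisions** (exported from the proof of `decoupling_extensive` for consumers that meet the
sandwich lemmas directly, e.g. the field-level transfer of seat dag-n08-d's `B1Eq324BenfattoKernelComparison`): with `B_bd`, `R = diag(r)`,
`ρ = (Σ_y r_y)/(γ − r_max)` as there, `√(det(B_bd + R)/det(B_bd − R)) ≤ e^{ρ}` and `e^{−ρ} ≤ √(det(B_bd − R)/det(B_bd + R))`.
[cite: BenfattoEtAl1978, (5.13) p.155 (class substitute; ours)] -/
theorem sqrt_det_comparison_ratio_le_exp {B : Matrix m m ℝ} (hB : ∀ y y', B y y' = B y' y) (π : m → σ) {γ rmax : ℝ}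
    (r : m → ℝ) (hγ : ∀ x : m → ℝ, γ * ∑ y, x y ^ 2 ≤ ∑ y, ∑ y', B y y' * x y * x y')
    (hr : ∀ y, ∑ y', (if π y = π y' then (0 : ℝ) else |B y y'|) ≤ r y) (hrmax : ∀ y, r y ≤ rmax) (hγr : rmax < γ) :
    let Bbd : Matrix m m ℝ := Matrix.of fun y y' => if π y = π y' then B y y' else 0
    let ρ : ℝ := (∑ y, r y) / (γ - rmax)
    Real.sqrt ((Bbd + Matrix.diagonal r).det / (Bbd - Matrix.diagonal r).det) ≤ Real.exp ρ ∧
      Real.exp (-ρ) ≤ Real.sqrt ((Bbd - Matrix.diagonal r).det / (Bbd + Matrix.diagonal r).det) := by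
  intro Bbd ρ
  obtain ⟨hPm, hPp, -, -, -⟩ := decoupling_extensive hB π r hγ hr hrmax hγr (fun _ => 0) measurable_const
  have hγ' : 0 < γ - rmax := by linarith
  have hr0 : ∀ y, 0 ≤ r y := fun y => le_trans (Finset.sum_nonneg fun y' _ => by
    split_ifs
    · exact le_rfl
    · exact abs_nonneg _) (hr y)
  have hBbd_symm : ∀ y y', Bbd y y' = Bbd y' y := by
    intro y y'
    simp only [Bbd, Matrix.of_apply]
    by_cases h : π y = π y'
    · rw [if_pos h, if_pos h.symm, hB y y']
    · rw [if_neg h, if_neg (fun h' => h h'.symm)]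
  have hdiag_symm : ∀ y y', Matrix.diagonal r y y' = Matrix.diagonal r y' y := fun y y' => by
    rw [← Matrix.diagonal_transpose, Matrix.transpose_apply, Matrix.diagonal_transpose]
  have hPm_symm : ∀ y y', (Bbd - Matrix.diagonal r) y y' = (Bbd - Matrix.diagonal r) y' y := fun y y' => by
    rw [Matrix.sub_apply, Matrix.sub_apply, hBbd_symm, hdiag_symm]
  have hPm_eq : Bbd - Matrix.diagonal r = Bbd + (-1 : ℝ) • Matrix.diagonal r := by rw [neg_one_smul, sub_eq_add_neg]
  have hPm_coer : ∀ x : m → ℝ, (γ - rmax) * ∑ y, x y ^ 2 ≤ ∑ y, ∑ y', (Bbd - Matrix.diagonal r) y y' * x y * x y' := by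
    intro x
    rw [hPm_eq]
    exact coercive_blockDiag_sub_diag π r hγ hrmax x
  have hPp_split : Bbd + Matrix.diagonal r = (Bbd - Matrix.diagonal r) + Matrix.diagonal (fun y => 2 * r y) := by
    ext y y'
    simp only [Matrix.add_apply, Matrix.sub_apply, Matrix.diagonal_apply]
    split_ifs <;> ring
  have hdet : (Bbd + Matrix.diagonal r).det ≤ (Bbd - Matrix.diagonal r).det * Real.exp (2 * ρ) := by
    rw [hPp_split, show 2 * ρ = 2 * ∑ y, r y / (γ - rmax) by
      simp only [ρ]; rw [Finset.sum_div]]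
    exact det_add_diag_le_det_mul_exp hPm_symm hγ' hPm_coer r hr0
  have hdm : 0 < (Bbd - Matrix.diagonal r).det := hPm.det_pos
  have hdp : 0 < (Bbd + Matrix.diagonal r).det := hPp.det_pos
  constructor
  · have h1 : (Bbd + Matrix.diagonal r).det / (Bbd - Matrix.diagonal r).det ≤ Real.exp ρ ^ 2 := by
      rw [div_le_iff₀ hdm, ← Real.exp_nat_mul]
      push_cast
      linarith
    calc Real.sqrt ((Bbd + Matrix.diagonal r).det / (Bbd - Matrix.diagonal r).det) ≤ Real.sqrt (Real.exp ρ ^ 2) :=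
          Real.sqrt_le_sqrt h1
      _ = Real.exp ρ := Real.sqrt_sq (Real.exp_pos _).le
  · have h1 : Real.exp (-ρ) ^ 2 ≤ (Bbd - Matrix.diagonal r).det / (Bbd + Matrix.diagonal r).det := by
      rw [le_div_iff₀ hdp, ← Real.exp_nat_mul]
      push_cast
      have h2 : Real.exp (2 * -ρ) * ((Bbd - Matrix.diagonal r).det * Real.exp (2 * ρ)) =
          (Bbd - Matrix.diagonal r).det := by
        rw [mul_comm, mul_assoc, ← Real.exp_add]; simp
      calc Real.exp (2 * -ρ) * (Bbd + Matrix.diagonal r).det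
          ≤ Real.exp (2 * -ρ) * ((Bbd - Matrix.diagonal r).det * Real.exp (2 * ρ)) :=
            mul_le_mul_of_nonneg_left hdet (Real.exp_pos _).le
        _ = (Bbd - Matrix.diagonal r).det := h2
    calc Real.exp (-ρ) = Real.sqrt (Real.exp (-ρ) ^ 2) := (Real.sqrt_sq (Real.exp_pos _).le).symm
      _ ≤ _ := Real.sqrt_le_sqrt h1

end ExtensiveMean

end Literature.MathematicalPhysics.QuantumFieldTheory.Balaban1983to89.B1Eq324BenfattoClassDecouplingExtensive

end
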